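import Literature.AlgebraicGeometry.FundamentalGroup.RiemannExistenceCurves
import Literature.AlgebraicGeometry.FundamentalGroup.RiemannExistenceQbarDescentProofs
import Literature.AlgebraicGeometry.Motives.GoodReductionSpecialFibreProofs
import HarnessLib

/-!
# Riemann's existence theorem for smooth complex curves

Layer `Literature/AlgebraicGeometry/FundamentalGroup`. **Every finite-fibred topological covering
of `X(ℂ)`, for `X` a smooth curve over `ℂ` (separated, smooth of relative dimension `1`), is the
space of complex points of a finite étale `X`-scheme**: the essential surjectivity in SGA1 XII
Thm. 5.1 («théorème d'existence de Riemann») in relative dimension `1`, i.e. the generalised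
Riemann existence theorem of function theory (Forster, §8 Thm. 8.4 with §14) —
`riemannExistence_smoothAffineCurve` (irreducible affine `X`) and `riemannExistence_smoothCurve`
(general `X`, by Zariski-localness and irreducible affine neighbourhoods).

Proof: the transcendental input in relative dimension `1`
(`integralSeparating_of_smoothOfRelativeDimension_one`: a continuous function integral over
`Γ(S, 𝒪_S)` separating a fibre), Theorem B (`CharPolyIntegral.exists_charPoly`: its characteristic
polynomial along the covering is a monic REGULAR polynomial, `Γ(S, 𝒪_S)` being integrally closed —
smooth ⇒ regular ⇒ normal) and Theorem A (`CharPoly.exists_finite_etale_homeomorph_of_charPoly_of_isCoveringMap`: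
algebraisation by standard étale algebras), exactly as in
`riemannExistence_qbarDescent_of_finiteIndex_of_integralSeparating`.

Everything is proved; there are no definitions.

## References

* A. Grothendieck, M. Raynaud, *SGA 1*, Exp. XII Thm. 5.1 (p. 333). [SGA1]
* O. Forster, *Lectures on Riemann Surfaces*, GTM 81, Springer (1981), §8 Thm. 8.4. [Forster1981]
-/

noncomputable section

open CategoryTheory AlgebraicGeometry Set
open Literature.AlgebraicGeometry.Motives
open Literature.AlgebraicGeometry.Resolution

namespace Literature.AlgebraicGeometry.FundamentalGroup

/-- **Riemann's existence theorem for smooth affine curves** (SGA1 XII Thm. 5.1, essential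
surjectivity, for `S` a smooth irreducible affine curve over `ℂ`): every covering map
`q : T → S(ℂ)` with finite fibres is isomorphic over `S(ℂ)` to `S'(ℂ) → S(ℂ)` for a finite étale
`g : S' → S`. [cite: SGA1, Exp. XII Thm. 5.1 (p. 333)] [cite: Forster1981, §8 Thm. 8.4] -/
theorem riemannExistence_smoothAffineCurve (S : SchemeOver ℂ) [IsAffine S.left]
    [SmoothOfRelativeDimension 1 S.hom] [IrreducibleSpace S.left] {T : Type} [TopologicalSpace T]
    (q : T → ComplexPoints S) (hq : IsCoveringMap q) (hfin : ∀ P, (q ⁻¹' {P}).Finite) :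
    ∃ (S' : SchemeOver ℂ) (g : S' ⟶ S) (Φ : ComplexPoints S' ≃ₜ T),
      IsFinite g.left ∧ Etale g.left ∧ ∀ z, q (Φ z) = AlgPoints.map g z := by
  haveI : Smooth S.hom := SmoothOfRelativeDimension.smooth 1 S.hom
  haveI : IsSeparated S.hom := inferInstance
  haveI : LocallyOfFiniteType S.hom := inferInstance
  -- the empty covering
  rcases isEmpty_or_nonempty T with hT | ⟨⟨t₀⟩⟩
  · refine CharPoly.exists_finite_etale_homeomorph_of_charPoly_of_isCoveringMap q hq hfin fun P₀ ↦ ?_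
    refine ⟨⊤, isAffineOpen_top S.left, trivial, fun _ ↦ 0, 1, continuousOn_const, Polynomial.monic_one,
      fun P _ ↦ ?_, fun t ↦ isEmptyElim t⟩
    have h0 : (hfin P).toFinset = ∅ := Finset.eq_empty_of_isEmpty _
    simp [h0]
  -- `Γ(S, 𝒪_S)` is an integrally closed domain: `S` is smooth over `ℂ` (regular) and irreducible
  have hSreg : Scheme.IsRegular S.left :=
    Scheme.IsRegular.of_smooth S.hom (Scheme.isRegular_Spec (CommRingCat.of ℂ))
  haveI : IsReduced S.left := hSreg.isReduced
  haveI : IsIntegral S.left := isIntegral_of_irreducibleSpace_of_isReduced _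
  haveI : Nonempty (⊤ : S.left.Opens) := ⟨⟨(q t₀).pt, trivial⟩⟩
  have hA : IsIntegrallyClosed Γ(S.left, ⊤) :=
    isIntegrallyClosed_sections_of_stalk (Y := S.left)
      (fun y ↦ haveI := hSreg y; isIntegrallyClosed_of_isRegularLocalRing _)
      ⟨⊤, isAffineOpen_top S.left⟩
  refine CharPoly.exists_finite_etale_homeomorph_of_charPoly_of_isCoveringMap q hq hfin fun P₀ ↦ ?_
  -- the transcendental input in relative dimension `1`, then Theorem B
  obtain ⟨h, R, hh, hR, hroot, hinj⟩ := integralSeparating_of_smoothOfRelativeDimension_one S hq hfin P₀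
  obtain ⟨Q, hQ, hroots⟩ := CharPolyIntegral.exists_charPoly (X := S) (U := ⊤)
    (isAffineOpen_top S.left) ⟨P₀.pt, trivial⟩ hA hq hfin h hh.continuousOn R hR (fun t _ ↦ hroot t)
  exact ⟨⊤, isAffineOpen_top S.left, trivial, h, Q, hh.continuousOn, hQ, hroots, hinj⟩

end Literature.AlgebraicGeometry.FundamentalGroup

namespace Literature.AlgebraicGeometry.FundamentalGroup

open TopologicalSpace in
/-- **Riemann's existence theorem for smooth complex curves** (SGA1 XII Thm. 5.1, essential
surjectivity, in relative dimension `1`): for `X` separated and smooth of relative dimension `1`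
over `ℂ`, every covering map `q : T → X(ℂ)` with finite fibres is `Y(ℂ) → X(ℂ)` for a finite étale
`g : Y → X`. Reduction to irreducible affine opens (the local rings of `X` are domains, so every point
has an irreducible affine neighbourhood) by the Zariski-localness of the statement
(`ZariskiLocal.exists_finite_etale_homeomorph_of_locally`). [cite: SGA1, Exp. XII Thm. 5.1 (p. 333)]
[cite: Forster1981, §8 Thm. 8.4] -/
theorem riemannExistence_smoothCurve (X : SchemeOver ℂ) [IsSeparated X.hom] [SmoothOfRelativeDimension 1 X.hom]
    {T : Type} [TopologicalSpace T] (q : T → ComplexPoints X) (hq : IsCoveringMap q)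
    (hfin : ∀ P, (q ⁻¹' {P}).Finite) :
    ∃ (Y : SchemeOver ℂ) (g : Y ⟶ X) (Φ : ComplexPoints Y ≃ₜ T),
      IsFinite g.left ∧ Etale g.left ∧ ∀ z, q (Φ z) = AlgPoints.map g z := by
  haveI : Smooth X.hom := SmoothOfRelativeDimension.smooth 1 X.hom
  haveI : LocallyOfFiniteType X.hom := inferInstance
  haveI : IsLocallyNoetherian X.left := LocallyOfFiniteType.isLocallyNoetherian X.hom
  refine ZariskiLocal.exists_finite_etale_homeomorph_of_locally q hq.continuous fun x ↦ ?_
  -- an irreducible affine open neighbourhood of `x`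
  haveI := isDomain_stalk_of_smoothOfRelativeDimension X.hom 1 x
  obtain ⟨W, hWo, hxW, hWirr⟩ := exists_isOpen_isIrreducible_of_isDomain_stalk X.left x
  obtain ⟨U, hU, hxU, hUW⟩ :=
    Opens.isBasis_iff_nbhd.mp X.left.isBasis_affineOpens (show x ∈ (⟨W, hWo⟩ : X.left.Opens) from hxW)
  haveI : IsAffine (openSubschemeOver X U).left := hU
  haveI : IrreducibleSpace (openSubschemeOver X U).left := by
    have hUirr : IsIrreducible (U : Set X.left) :=
      ⟨⟨x, hxU⟩, hWirr.2.open_subset U.2 fun y hy ↦ hUW hy⟩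
    exact Subtype.irreducibleSpace hUirr
  haveI : SmoothOfRelativeDimension 1 (openSubschemeOver X U).hom :=
    inferInstanceAs (SmoothOfRelativeDimension (0 + 1) (Scheme.Opens.ι U ≫ X.hom))
  obtain ⟨Y, g₀, Φ₀, hfi, het, h₀⟩ := riemannExistence_smoothAffineCurve (openSubschemeOver X U)
    (ZariskiLocal.restrictTo q U) (ZariskiLocal.isCoveringMap_restrictTo q U hq)
    (ZariskiLocal.finite_preimage_restrictTo q U hfin)
  haveI := hfi
  haveI := het
  exact ⟨U, hxU, ⟨ZariskiLocal.LocalAlgebraization.ofLocal g₀ Φ₀ h₀⟩⟩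

end Literature.AlgebraicGeometry.FundamentalGroup
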